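import Summits.QuantumFields.YangMills.Theorems.SmallFieldWideningPlainStabAddOfLocalStep
import Summits.QuantumFields.YangMills.Theorems.SmallFieldWideningPlainStabAdd

/-!
# Route `SmallFieldWidening`, crux `PlainStabAdd` (stmt-QuantumFields-27718; LINE g6-B «additive unit-stability ladder» of planner ym-idea-1 g6, child of crux r3
# `LargeFieldMassRefinementTail` stmt-QuantumFields-22884) — THE RESTRICT HALF IN THE «local-split» QUANTIFIER SHAPE (`η`-dependent starting run, locality exponent
# and threshold; the supplier's own base with a rate floor), AND THE CRUXES BY NAME
# (support file; width seat `ym-line-sfw-p2-w3` gen 24; companion of `…PlainStabAddOfLocalStep` (p631873); `PlainStabAdd`, r3 and rung R3 stay OPEN — the YM mass gap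
# is NOT proved by any of this)

WHAT.  §4 ★★ `plainStabAdd_of_localStepFloor`: `PlainStabAdd` BY NAME from `LocalStepFloor` — the purely multiplicative one-step, one-sided comparison of the
(threshold-multiplied) unit-plaquette tails `Gibbs_{K+1}({t_{K+1}θ(0) ≤ |Ū^{K+1}(∂q) − 1|} ∩ PlaqSmallOn S_K θ_{b'}(K+1)) ≤ e^{ρ_K} Gibbs_K{t_Kθ(0) ≤ |Ū^K(∂q) − 1|}`
(`K ≥ k₀`) on an ARBITRARY supplier-chosen set `S_K` of finest plaquettes of run `K+1` with `|S_K| ≤ (L^{K+1})^M`, in the quantifier shape of the line's skeleton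
«local-split» (`Cruxes/PlainStabAdd`, stub `stub_localSmallStep`): the base RATE FLOOR `c_b` and the guard profile `b'` are fixed before the precision `η`; the
starting run `k₀`, the base constants `C_b, N_b`, the locality exponent `M`, `γ₁` and `A` may depend on `η` («start higher ⇒ smaller slack»).  The additive slack of
`PlainStabAdd` is discharged exactly as in the companion file (`PlainStabAddOfLocalStep.slack_sum_le`: only `C_τ` depends on `M`; `c_τ = c·(b'/b₀)²` and `N_τ` do not),
`η := min(c_b, c_τ)/2`.  `stub_localSmallStep` implies `LocalStepFloor` once the column `nearCol F (K+1) r q` is counted (`|nearCol| ≤ (L^{K+1})^{M(r)}`, part of the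
line's other stub — not proved here); conversely `LocalStepFloor` frees the supplier from the column geometry and from the guard profile.
§5: r3 `LargeFieldMassRefinementTail` (22884), `FirstExitWindowTailL` (26243), `HistoryTailL` (19936) ⇐ `LocalStepFloor`, and r3 ⇐ `LocalStep` (the companion's
§3 shape), BY NAME, via the planner's glue `LargeFieldMassRefinementTailPlainStabAdd.*_of_plainStabAdd` (p631613).

WHAT THIS IS NOT.  Neither hypothesis is proved (they are the crux's open content: [Balaban1985UV3] (7), (70)–(71); [Balaban1987RG1] Thm 1); nothing bears on the
Yang–Mills mass gap; rung R3 (`YM3TorusSU2`) is a RECORD rung; cruxes 27718 / 22884 / 26243 / 19936 stay open.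
-/

noncomputable section

open MeasureTheory Filter Topology
open scoped BigOperators
open Literature.MathematicalPhysics.QuantumFieldTheory.Balaban1983to89
open Literature.MathematicalPhysics.QuantumFieldTheory.Balaban1983to89.Missing
open Literature.MathematicalPhysics.QuantumFieldTheory.Balaban1983to89.T3ContinuumYM3Torus
open Literature.MathematicalPhysics.QuantumFieldTheory.Balaban1983to89.T3UnitScaleTilt
open Literature.MathematicalPhysics.QuantumFieldTheory.Balaban1983to89.T3UnitLawDensityEML (ℰp)
open Literature.MathematicalPhysics.QuantumFieldTheory.Balaban1983to89.T3LevelShift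
open Summit.QuantumFields.YangMills.Theorems.FirstExitDeepBoundedHeight (perPlaquette_boundedHeight_uniform)
open Summit.QuantumFields.YangMills.Theorems.PlainStabAddOfLocalStep (slack_sum_le pFun_sq_rescale plainStabAdd_of_localStep)

namespace Summit.QuantumFields.YangMills.Theorems.PlainStabAddOfLocalStepFloor

/-! ## §4 The FLOOR form: `η`-dependent starting run, locality exponent and threshold; the supplier's own base with a rate floor

The line's skeleton «local-split» (planner ym-idea-1 g6; `Cruxes/PlainStabAdd`, stubs `stub_localSmallStep` (XL) / `stub_localNewLevelTail` (M)) lets the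
starting run `k₀`, the locality radius and `γ₁` depend on the precision `η`, at the price of a base tail supplied by the prover with a rate floor `c_b` fixed
BEFORE `η` («start higher ⇒ smaller slack»).  The twin below has exactly that quantifier shape, with the guard still an ARBITRARY polynomial-size set of finest
plaquettes at a free guard profile `b'` (the locality exponent `M` may depend on `η`: only `C_τ` depends on `M`, not `c_τ`, `N_τ`).  In the tree's vocabulary the
guard event is `PlaqSmallOn ↑(S_K) (θ_{b'}(K+1))`.  `stub_localSmallStep` implies this hypothesis once the column `nearCol F (K+1) r q` is counted
(`|nearCol| ≤ (L^{K+1})^{M(r)}` — part of `stub_localNewLevelTail`, not proved here). -/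

/-- ★★ **`PlainStabAdd` ⇐ `LocalStepFloor`** — the «local-split» quantifier shape: for every `L, b₀ > 0, p₀ > 2` there are a BASE RATE FLOOR `c_b > 0` and a guard
profile `b' > 0` such that for every `η > 0` there are `k₀ ≥ 1`, `N_b`, a locality exponent `M`, `γ₁ ∈ (0,1]`, `C_b ≥ 0` and `A` with: for every family `F`
(`F.L = L`), `0 < γ ≤ γ₁`, unit plaquette label `q` there are `ρ, t ∈ [1/2,1]` and finest-plaquette sets `S_K` of run `K+1`, `|S_K| ≤ (L^{K+1})^M` (`K ≥ k₀`), such that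
(base) `Gibbs_{k₀}{t_{k₀}θ(0) ≤ |Ū^{k₀}(∂q) − 1|} ≤ C_b γ^{-N_b} e^{−c_b p(√γ)²}`, (slack) every interval sum `Σ_{k≤j<K} ρ_j ≤ A + η p(√γ)²` (`k ≥ k₀`), and (step) for `K ≥ k₀`
`Gibbs_{K+1}({t_{K+1}θ(0) ≤ |Ū^{K+1}(∂q) − 1|} ∩ PlaqSmallOn S_K θ_{b'}(K+1)) ≤ e^{ρ_K} Gibbs_K{t_Kθ(0) ≤ |Ū^K(∂q) − 1|}`.
CONCLUSION `PlainStabAdd` BY NAME: `c_τ := c·(b'/b₀)²` from the finest-height tail at profile `b'` (fixed before `η`), `η := min(c_b, c_τ)/2`, then the supplier's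
`k₀, N_b, M, γ₁, C_b, A`, `C_τ := 2C e^{c b'²} e^{B(M)²/(4α)}`, `τ_K := |S_K|`·(finest tail), `slack_sum_le`.  Conditional certificate: the hypothesis is NOT proved;
nothing about the mass gap; rung R3 is a RECORD rung. [cite: Balaban1985UV3, (7) p.257 and (70)-(71) p.273; Balaban1987RG1, Thm 1 p.259] -/
theorem plainStabAdd_of_localStepFloor
    (hLS : ∀ (L : ℕ) (b₀ p₀ : ℝ), 0 < b₀ → 2 < p₀ → ∃ (cb b' : ℝ), 0 < cb ∧ 0 < b' ∧ ∀ η : ℝ, 0 < η →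
      ∃ (k₀ Nb M : ℕ) (γ₁ Cb A : ℝ), 1 ≤ k₀ ∧ 0 < γ₁ ∧ γ₁ ≤ 1 ∧ 0 ≤ Cb ∧
      ∀ (F : T3Family) (γ : ℝ), F.L = L → 0 < γ → γ ≤ γ₁ →
        ∀ q : Plaq (F.P 0) 0, ∃ (ρ t : ℕ → ℝ) (S : (K : ℕ) → Finset (Plaq (F.P (K + 1)) 0)),
          (∀ K : ℕ, 1 / 2 ≤ t K ∧ t K ≤ 1) ∧
          (gibbsK F ℰp γ k₀).real {U | t k₀ * θBal F.L γ b₀ p₀ 0 ≤ GaugeGroup.dist1 (GaugeField.plaqHol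
                (Averaging.iter (fun i => BlockAveraging.blockAvg (P := F.P k₀) (j := i) ℰp) k₀ U) (plaqShift (F.sitesPerDir_unit k₀) q))} ≤
            Cb * (γ⁻¹) ^ Nb * Real.exp (-(cb * B10.pFun b₀ p₀ (Real.sqrt γ) ^ 2)) ∧
          (∀ k K : ℕ, k₀ ≤ k → ∑ j ∈ Finset.Ico k K, ρ j ≤ A + η * B10.pFun b₀ p₀ (Real.sqrt γ) ^ 2) ∧
          (∀ K : ℕ, k₀ ≤ K → ((S K).card : ℝ) ≤ ((F.L : ℝ) ^ (K + 1)) ^ M) ∧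
          ∀ K : ℕ, k₀ ≤ K →
            (gibbsK F ℰp γ (K + 1)).real ({U | t (K + 1) * θBal F.L γ b₀ p₀ 0 ≤ GaugeGroup.dist1 (GaugeField.plaqHol
                (Averaging.iter (fun i => BlockAveraging.blockAvg (P := F.P (K + 1)) (j := i) ℰp) (K + 1) U)
                (plaqShift (F.sitesPerDir_unit (K + 1)) q))} ∩
              {U | PlaqSmallOn (↑(S K) : Set (Plaq (F.P (K + 1)) 0)) (θBal F.L γ b' p₀ (K + 1)) U}) ≤
            Real.exp (ρ K) *
            (gibbsK F ℰp γ K).real {U | t K * θBal F.L γ b₀ p₀ 0 ≤ GaugeGroup.dist1 (GaugeField.plaqHol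
                (Averaging.iter (fun i => BlockAveraging.blockAvg (P := F.P K) (j := i) ℰp) K U)
                (plaqShift (F.sitesPerDir_unit K) q))}) :
    Summit.QuantumFields.YangMills.Theses.SmallFieldWidening.PlainStabAdd := by
  unfold Summit.QuantumFields.YangMills.Theses.SmallFieldWidening.PlainStabAdd
  intro L b₀ p₀ hb₀ hp₀
  obtain ⟨cb, b', hcb, hb', hstep⟩ := hLS L b₀ p₀ hb₀ hp₀
  -- the tree's volume-uniform finest-height tail at the guard profile `b'` (fixes `c_τ` BEFORE `η`)
  obtain ⟨γf, C, c, N, hγf, hγf1, hc, hC, hfin⟩ := perPlaquette_boundedHeight_uniform 0 L b' p₀ hb' (by linarith)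
  by_cases hL : 1 < L
  swap
  · refine ⟨1, 0, 0, 1, 0, 1, 0, 1, 0, 0, le_rfl, one_pos, le_rfl, le_rfl, le_rfl, le_rfl, one_pos, one_pos, fun F γ hFL => ?_⟩
    exact absurd (hFL ▸ F.hL.2) hL
  have hp₀1 : 1 ≤ p₀ := by linarith
  set cτ : ℝ := c * (b' / b₀) ^ 2 with hcτ
  have hcτ0 : 0 < cτ := by positivity
  set η : ℝ := min cb cτ / 2 with hη
  have hη0 : 0 < η := by positivity
  have hηb : η < cb := by
    have := min_le_left cb cτ
    rw [hη]; linarith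
  have hητ : η < cτ := by
    have := min_le_right cb cτ
    rw [hη]; linarith
  obtain ⟨k₀, Nb, M, γs, Cb, A, hk₀, hγs, hγs1, hCb, hA⟩ := hstep η hη0
  set Cτ : ℝ := 2 * (C * Real.exp (c * b' ^ 2) *
      Real.exp ((((M : ℝ) + N) * Real.log L + Real.log 2) ^ 2 / (4 * (c * b' ^ 2 * Real.log L ^ 2 / 4)))) with hCτ
  refine ⟨k₀, Nb, N, min γf γs, Cb, cb, Cτ, cτ, η, A, hk₀, lt_min hγf hγs, (min_le_right _ _).trans hγs1, hCb, by positivity,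
    hη0.le, hηb, hητ, fun F γ hFL hγ hle q => ?_⟩
  have hleF : γ ≤ γf := hle.trans (min_le_left _ _)
  have hγ1 : γ ≤ 1 := hleF.trans hγf1
  obtain ⟨ρ, t, S, ht, hbase, hρ, hS, hst⟩ := hA F γ hFL hγ (hle.trans (min_le_right _ _)) q
  refine ⟨ρ, fun K => ((S K).card : ℝ) * (C * ((γ * ((F.L : ℝ)⁻¹) ^ (K + 1))⁻¹) ^ N *
      Real.exp (-(c * B10.pFun b' p₀ (Real.sqrt (γ * ((F.L : ℝ)⁻¹) ^ (K + 1))) ^ 2))), t, ht, hbase, hρ,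
    fun K => by positivity, fun K => ?_, fun K hK => ?_⟩
  · -- the slack budget, uniformly in `K`, `γ` and the volume
    rw [hFL]
    have hsum := slack_sum_le hL M N k₀ hb' hp₀1 hc hC hγ hγ1 (fun k => ((S k).card : ℝ)) (fun k hk => hFL ▸ hS k hk) K
    rw [pFun_sq_rescale hb₀.ne' b' p₀ (Real.sqrt γ)] at hsum
    have heq : -(c * ((b' / b₀) ^ 2 * B10.pFun b₀ p₀ (Real.sqrt γ) ^ 2)) = -(cτ * B10.pFun b₀ p₀ (Real.sqrt γ) ^ 2) := by
      rw [hcτ]; ring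
    rw [heq] at hsum
    exact hsum
  · -- the step: split on the local finest-small-field event, union bound on its complement
    haveI := isProbabilityMeasure_gibbsK F ℰp hγ.le (K + 1)
    have hb : ∀ p : Plaq (F.P (K + 1)) 0,
        (gibbsK F ℰp γ (K + 1)).real {U | θBal F.L γ b' p₀ (K + 1) ≤ GaugeGroup.dist1 (GaugeField.plaqHol U p)} ≤
          C * ((γ * ((F.L : ℝ)⁻¹) ^ (K + 1))⁻¹) ^ N *
            Real.exp (-(c * B10.pFun b' p₀ (Real.sqrt (γ * ((F.L : ℝ)⁻¹) ^ (K + 1))) ^ 2)) := fun p =>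
      hfin F γ hFL hγ hleF (K + 1) 0 (Nat.zero_le _) le_rfl p
    set E : Set (GaugeField (F.P (K + 1)) 0 (Matrix.specialUnitaryGroup (Fin 2) ℂ)) :=
      {U | t (K + 1) * θBal F.L γ b₀ p₀ 0 ≤ GaugeGroup.dist1 (GaugeField.plaqHol
        (Averaging.iter (fun i => BlockAveraging.blockAvg (P := F.P (K + 1)) (j := i) ℰp) (K + 1) U)
        (plaqShift (F.sitesPerDir_unit (K + 1)) q))} with hE
    set G : Set (GaugeField (F.P (K + 1)) 0 (Matrix.specialUnitaryGroup (Fin 2) ℂ)) :=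
      {U | PlaqSmallOn (↑(S K) : Set (Plaq (F.P (K + 1)) 0)) (θBal F.L γ b' p₀ (K + 1)) U} with hG
    have hsplit : E ⊆ (E ∩ G) ∪ ⋃ p ∈ S K,
        {U : GaugeField (F.P (K + 1)) 0 (Matrix.specialUnitaryGroup (Fin 2) ℂ) |
          θBal F.L γ b' p₀ (K + 1) ≤ GaugeGroup.dist1 (GaugeField.plaqHol U p)} := by
      intro U hU
      by_cases hGU : U ∈ G
      · exact Or.inl ⟨hU, hGU⟩
      · right
        simp only [hG, Set.mem_setOf_eq, PlaqSmallOn, Finset.mem_coe, not_forall, not_lt, exists_prop] at hGU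
        obtain ⟨p, hp, hle'⟩ := hGU
        exact Set.mem_iUnion₂.mpr ⟨p, hp, hle'⟩
    calc (gibbsK F ℰp γ (K + 1)).real E
        ≤ (gibbsK F ℰp γ (K + 1)).real ((E ∩ G) ∪ ⋃ p ∈ S K,
            {U : GaugeField (F.P (K + 1)) 0 (Matrix.specialUnitaryGroup (Fin 2) ℂ) |
              θBal F.L γ b' p₀ (K + 1) ≤ GaugeGroup.dist1 (GaugeField.plaqHol U p)}) :=
          measureReal_mono hsplit (measure_ne_top _ _)
      _ ≤ (gibbsK F ℰp γ (K + 1)).real (E ∩ G) + (gibbsK F ℰp γ (K + 1)).real (⋃ p ∈ S K,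
            {U : GaugeField (F.P (K + 1)) 0 (Matrix.specialUnitaryGroup (Fin 2) ℂ) |
              θBal F.L γ b' p₀ (K + 1) ≤ GaugeGroup.dist1 (GaugeField.plaqHol U p)}) :=
          measureReal_union_le _ _
      _ ≤ Real.exp (ρ K) * (gibbsK F ℰp γ K).real {U | t K * θBal F.L γ b₀ p₀ 0 ≤ GaugeGroup.dist1 (GaugeField.plaqHol
              (Averaging.iter (fun i => BlockAveraging.blockAvg (P := F.P K) (j := i) ℰp) K U)
              (plaqShift (F.sitesPerDir_unit K) q))} +
            ∑ p ∈ S K, (gibbsK F ℰp γ (K + 1)).real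
              {U : GaugeField (F.P (K + 1)) 0 (Matrix.specialUnitaryGroup (Fin 2) ℂ) |
                θBal F.L γ b' p₀ (K + 1) ≤ GaugeGroup.dist1 (GaugeField.plaqHol U p)} :=
          add_le_add (hst K hK) (measureReal_biUnion_finset_le _ _)
      _ ≤ Real.exp (ρ K) * (gibbsK F ℰp γ K).real {U | t K * θBal F.L γ b₀ p₀ 0 ≤ GaugeGroup.dist1 (GaugeField.plaqHol
              (Averaging.iter (fun i => BlockAveraging.blockAvg (P := F.P K) (j := i) ℰp) K U)
              (plaqShift (F.sitesPerDir_unit K) q))} +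
            ∑ _p ∈ S K, C * ((γ * ((F.L : ℝ)⁻¹) ^ (K + 1))⁻¹) ^ N *
              Real.exp (-(c * B10.pFun b' p₀ (Real.sqrt (γ * ((F.L : ℝ)⁻¹) ^ (K + 1))) ^ 2)) :=
          add_le_add le_rfl (Finset.sum_le_sum fun p _ => hb p)
      _ = _ := by rw [Finset.sum_const, nsmul_eq_mul]

/-! ## §5 The cruxes by name (via the planner's glue `LargeFieldMassRefinementTailPlainStabAdd`, p631613) -/

/-- **r3 `LargeFieldMassRefinementTail` (stmt-QuantumFields-22884) ⇐ `LocalStepFloor`.**  Conditional certificate (composition with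
`LargeFieldMassRefinementTailPlainStabAdd.largeFieldMassRefinementTail_of_plainStabAdd`); nothing about the mass gap. [cite: Balaban1985UV3, (70)-(71) p.273] -/
theorem largeFieldMassRefinementTail_of_localStepFloor
    (hLS : ∀ (L : ℕ) (b₀ p₀ : ℝ), 0 < b₀ → 2 < p₀ → ∃ (cb b' : ℝ), 0 < cb ∧ 0 < b' ∧ ∀ η : ℝ, 0 < η →
      ∃ (k₀ Nb M : ℕ) (γ₁ Cb A : ℝ), 1 ≤ k₀ ∧ 0 < γ₁ ∧ γ₁ ≤ 1 ∧ 0 ≤ Cb ∧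
      ∀ (F : T3Family) (γ : ℝ), F.L = L → 0 < γ → γ ≤ γ₁ →
        ∀ q : Plaq (F.P 0) 0, ∃ (ρ t : ℕ → ℝ) (S : (K : ℕ) → Finset (Plaq (F.P (K + 1)) 0)),
          (∀ K : ℕ, 1 / 2 ≤ t K ∧ t K ≤ 1) ∧
          (gibbsK F ℰp γ k₀).real {U | t k₀ * θBal F.L γ b₀ p₀ 0 ≤ GaugeGroup.dist1 (GaugeField.plaqHol
                (Averaging.iter (fun i => BlockAveraging.blockAvg (P := F.P k₀) (j := i) ℰp) k₀ U) (plaqShift (F.sitesPerDir_unit k₀) q))} ≤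
            Cb * (γ⁻¹) ^ Nb * Real.exp (-(cb * B10.pFun b₀ p₀ (Real.sqrt γ) ^ 2)) ∧
          (∀ k K : ℕ, k₀ ≤ k → ∑ j ∈ Finset.Ico k K, ρ j ≤ A + η * B10.pFun b₀ p₀ (Real.sqrt γ) ^ 2) ∧
          (∀ K : ℕ, k₀ ≤ K → ((S K).card : ℝ) ≤ ((F.L : ℝ) ^ (K + 1)) ^ M) ∧
          ∀ K : ℕ, k₀ ≤ K →
            (gibbsK F ℰp γ (K + 1)).real ({U | t (K + 1) * θBal F.L γ b₀ p₀ 0 ≤ GaugeGroup.dist1 (GaugeField.plaqHol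
                (Averaging.iter (fun i => BlockAveraging.blockAvg (P := F.P (K + 1)) (j := i) ℰp) (K + 1) U)
                (plaqShift (F.sitesPerDir_unit (K + 1)) q))} ∩
              {U | PlaqSmallOn (↑(S K) : Set (Plaq (F.P (K + 1)) 0)) (θBal F.L γ b' p₀ (K + 1)) U}) ≤
            Real.exp (ρ K) *
            (gibbsK F ℰp γ K).real {U | t K * θBal F.L γ b₀ p₀ 0 ≤ GaugeGroup.dist1 (GaugeField.plaqHol
                (Averaging.iter (fun i => BlockAveraging.blockAvg (P := F.P K) (j := i) ℰp) K U)
                (plaqShift (F.sitesPerDir_unit K) q))}) :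
    Summit.QuantumFields.YangMills.Theses.SmallFieldWidening.LargeFieldMassRefinementTail :=
  LargeFieldMassRefinementTailPlainStabAdd.largeFieldMassRefinementTail_of_plainStabAdd (plainStabAdd_of_localStepFloor hLS)

/-- **`FirstExitWindowTailL` (stmt-QuantumFields-26243) ⇐ `LocalStepFloor`.**  Conditional certificate. [cite: Balaban1985UV3, (70)-(71) p.273] -/
theorem firstExitWindowTailL_of_localStepFloor
    (hLS : ∀ (L : ℕ) (b₀ p₀ : ℝ), 0 < b₀ → 2 < p₀ → ∃ (cb b' : ℝ), 0 < cb ∧ 0 < b' ∧ ∀ η : ℝ, 0 < η →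
      ∃ (k₀ Nb M : ℕ) (γ₁ Cb A : ℝ), 1 ≤ k₀ ∧ 0 < γ₁ ∧ γ₁ ≤ 1 ∧ 0 ≤ Cb ∧
      ∀ (F : T3Family) (γ : ℝ), F.L = L → 0 < γ → γ ≤ γ₁ →
        ∀ q : Plaq (F.P 0) 0, ∃ (ρ t : ℕ → ℝ) (S : (K : ℕ) → Finset (Plaq (F.P (K + 1)) 0)),
          (∀ K : ℕ, 1 / 2 ≤ t K ∧ t K ≤ 1) ∧
          (gibbsK F ℰp γ k₀).real {U | t k₀ * θBal F.L γ b₀ p₀ 0 ≤ GaugeGroup.dist1 (GaugeField.plaqHol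
                (Averaging.iter (fun i => BlockAveraging.blockAvg (P := F.P k₀) (j := i) ℰp) k₀ U) (plaqShift (F.sitesPerDir_unit k₀) q))} ≤
            Cb * (γ⁻¹) ^ Nb * Real.exp (-(cb * B10.pFun b₀ p₀ (Real.sqrt γ) ^ 2)) ∧
          (∀ k K : ℕ, k₀ ≤ k → ∑ j ∈ Finset.Ico k K, ρ j ≤ A + η * B10.pFun b₀ p₀ (Real.sqrt γ) ^ 2) ∧
          (∀ K : ℕ, k₀ ≤ K → ((S K).card : ℝ) ≤ ((F.L : ℝ) ^ (K + 1)) ^ M) ∧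
          ∀ K : ℕ, k₀ ≤ K →
            (gibbsK F ℰp γ (K + 1)).real ({U | t (K + 1) * θBal F.L γ b₀ p₀ 0 ≤ GaugeGroup.dist1 (GaugeField.plaqHol
                (Averaging.iter (fun i => BlockAveraging.blockAvg (P := F.P (K + 1)) (j := i) ℰp) (K + 1) U)
                (plaqShift (F.sitesPerDir_unit (K + 1)) q))} ∩
              {U | PlaqSmallOn (↑(S K) : Set (Plaq (F.P (K + 1)) 0)) (θBal F.L γ b' p₀ (K + 1)) U}) ≤
            Real.exp (ρ K) *
            (gibbsK F ℰp γ K).real {U | t K * θBal F.L γ b₀ p₀ 0 ≤ GaugeGroup.dist1 (GaugeField.plaqHol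
                (Averaging.iter (fun i => BlockAveraging.blockAvg (P := F.P K) (j := i) ℰp) K U)
                (plaqShift (F.sitesPerDir_unit K) q))}) :
    Summit.QuantumFields.YangMills.Theses.FirstExitWindow.FirstExitWindowTailL :=
  LargeFieldMassRefinementTailPlainStabAdd.firstExitWindowTailL_of_plainStabAdd (plainStabAdd_of_localStepFloor hLS)

/-- **K2′ `HistoryTailL` (stmt-QuantumFields-19936) ⇐ `LocalStepFloor`.**  Conditional certificate. [cite: Balaban1985UV3, (70)-(71) p.273] -/
theorem historyTailL_of_localStepFloor
    (hLS : ∀ (L : ℕ) (b₀ p₀ : ℝ), 0 < b₀ → 2 < p₀ → ∃ (cb b' : ℝ), 0 < cb ∧ 0 < b' ∧ ∀ η : ℝ, 0 < η →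
      ∃ (k₀ Nb M : ℕ) (γ₁ Cb A : ℝ), 1 ≤ k₀ ∧ 0 < γ₁ ∧ γ₁ ≤ 1 ∧ 0 ≤ Cb ∧
      ∀ (F : T3Family) (γ : ℝ), F.L = L → 0 < γ → γ ≤ γ₁ →
        ∀ q : Plaq (F.P 0) 0, ∃ (ρ t : ℕ → ℝ) (S : (K : ℕ) → Finset (Plaq (F.P (K + 1)) 0)),
          (∀ K : ℕ, 1 / 2 ≤ t K ∧ t K ≤ 1) ∧
          (gibbsK F ℰp γ k₀).real {U | t k₀ * θBal F.L γ b₀ p₀ 0 ≤ GaugeGroup.dist1 (GaugeField.plaqHol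
                (Averaging.iter (fun i => BlockAveraging.blockAvg (P := F.P k₀) (j := i) ℰp) k₀ U) (plaqShift (F.sitesPerDir_unit k₀) q))} ≤
            Cb * (γ⁻¹) ^ Nb * Real.exp (-(cb * B10.pFun b₀ p₀ (Real.sqrt γ) ^ 2)) ∧
          (∀ k K : ℕ, k₀ ≤ k → ∑ j ∈ Finset.Ico k K, ρ j ≤ A + η * B10.pFun b₀ p₀ (Real.sqrt γ) ^ 2) ∧
          (∀ K : ℕ, k₀ ≤ K → ((S K).card : ℝ) ≤ ((F.L : ℝ) ^ (K + 1)) ^ M) ∧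
          ∀ K : ℕ, k₀ ≤ K →
            (gibbsK F ℰp γ (K + 1)).real ({U | t (K + 1) * θBal F.L γ b₀ p₀ 0 ≤ GaugeGroup.dist1 (GaugeField.plaqHol
                (Averaging.iter (fun i => BlockAveraging.blockAvg (P := F.P (K + 1)) (j := i) ℰp) (K + 1) U)
                (plaqShift (F.sitesPerDir_unit (K + 1)) q))} ∩
              {U | PlaqSmallOn (↑(S K) : Set (Plaq (F.P (K + 1)) 0)) (θBal F.L γ b' p₀ (K + 1)) U}) ≤
            Real.exp (ρ K) *
            (gibbsK F ℰp γ K).real {U | t K * θBal F.L γ b₀ p₀ 0 ≤ GaugeGroup.dist1 (GaugeField.plaqHol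
                (Averaging.iter (fun i => BlockAveraging.blockAvg (P := F.P K) (j := i) ℰp) K U)
                (plaqShift (F.sitesPerDir_unit K) q))}) :
    Summit.QuantumFields.YangMills.Theses.UnitScaleTilt.HistoryTailL :=
  LargeFieldMassRefinementTailPlainStabAdd.historyTailL_of_plainStabAdd (plainStabAdd_of_localStepFloor hLS)

/-- **r3 `LargeFieldMassRefinementTail` (stmt-QuantumFields-22884) ⇐ `LocalStep`** (the §3 shape: `k₀, M, γ₁, b'` before `η`, base from the tree).  Conditional
certificate; nothing about the mass gap. [cite: Balaban1985UV3, (70)-(71) p.273] -/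
theorem largeFieldMassRefinementTail_of_localStep
    (hLS : ∀ (L : ℕ) (b₀ p₀ : ℝ), 0 < b₀ → 2 < p₀ → ∃ (k₀ M : ℕ) (γ₁ b' : ℝ), 1 ≤ k₀ ∧ 0 < γ₁ ∧ γ₁ ≤ 1 ∧ 0 < b' ∧
      ∀ η : ℝ, 0 < η → ∃ A : ℝ, ∀ (F : T3Family) (γ : ℝ), F.L = L → 0 < γ → γ ≤ γ₁ →
        ∀ q : Plaq (F.P 0) 0, ∃ (ρ t : ℕ → ℝ) (S : (K : ℕ) → Finset (Plaq (F.P (K + 1)) 0)),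
          (∀ K : ℕ, 1 / 2 ≤ t K ∧ t K ≤ 1) ∧
          (∀ k K : ℕ, k₀ ≤ k → ∑ j ∈ Finset.Ico k K, ρ j ≤ A + η * B10.pFun b₀ p₀ (Real.sqrt γ) ^ 2) ∧
          (∀ K : ℕ, k₀ ≤ K → ((S K).card : ℝ) ≤ ((F.L : ℝ) ^ (K + 1)) ^ M) ∧
          ∀ K : ℕ, k₀ ≤ K →
            (gibbsK F ℰp γ (K + 1)).real ({U | t (K + 1) * θBal F.L γ b₀ p₀ 0 ≤ GaugeGroup.dist1 (GaugeField.plaqHol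
                (Averaging.iter (fun i => BlockAveraging.blockAvg (P := F.P (K + 1)) (j := i) ℰp) (K + 1) U)
                (plaqShift (F.sitesPerDir_unit (K + 1)) q))} ∩
              {U | ∀ p ∈ S K, GaugeGroup.dist1 (GaugeField.plaqHol U p) < θBal F.L γ b' p₀ (K + 1)}) ≤
            Real.exp (ρ K) *
            (gibbsK F ℰp γ K).real {U | t K * θBal F.L γ b₀ p₀ 0 ≤ GaugeGroup.dist1 (GaugeField.plaqHol
                (Averaging.iter (fun i => BlockAveraging.blockAvg (P := F.P K) (j := i) ℰp) K U)
                (plaqShift (F.sitesPerDir_unit K) q))}) :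
    Summit.QuantumFields.YangMills.Theses.SmallFieldWidening.LargeFieldMassRefinementTail :=
  LargeFieldMassRefinementTailPlainStabAdd.largeFieldMassRefinementTail_of_plainStabAdd (plainStabAdd_of_localStep hLS)

end Summit.QuantumFields.YangMills.Theorems.PlainStabAddOfLocalStepFloor

end
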